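import Summits.QuantumFields.BalabanUV.T4Continuum.Support.SubspacePairPerturbation
import Summits.QuantumFields.BalabanUV.T4Continuum.Support.RegularGaugePerturbation
import Summits.QuantumFields.BalabanUV.T4Continuum.Support.VariationalVectorGaugeSliceB5
import Summits.QuantumFields.BalabanUV.T4Continuum.Support.CovariantSliceComplement

/-!
# T⁴ programme, spine node NE2 (U1a), lane P2 — (GF3) WITH BACKGROUND FROM ONE DISPLAYED DATUM: if the flat slice subspace `S_1(ker Q′_1)` is one-sidedly
# `δ`-close to the covariant one `S_R(K)`, then `n^{−d}(n²·divSq_R W) ≤ (36C_f + 8)·ScV n M R (projG R K) W + (24C_f + 4)·nsqV (Q W)` for ANY submodule `K`,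
# ANY average `Q` comparable to the flat line average, `‖R − 1‖ ≤ a` — NO plaquette hypothesis, NO Poincaré inequality with background (model level, `E = ℂ`)

NE2 formalisation swarm `b2b-balaban-t4-ne2-formalise-*`, leaf prover 04 GEN 6 (`prover-b2b-balaban-t4-ne2-formalise-leaf-04-g6-0`); journal INTENT
CLAIMS.log l.18848 «(GF3) WITH BACKGROUND FOR COVARIANT FRAMES — THE SLICE GAP THROUGH THE COMPLEMENT», file 2 (the generic assembly; file 1 =
`SliceComplementFlatGap` supplies the datum for covariant frames, file 3 = `DivControlCovariantFrames` plugs it in).  On top of leaf-03-g6's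
`SubspacePairPerturbation.{norm_sub_starProjection_le_of_oneSided, norm_sub_starProjection_le}` (p229878), `RegularGaugePerturbation.{curlSq_flat_le,
nsqv_divV_sub_flat_le}` (p229998), `CovariantSliceComplement.{projDiv, divSq_eq_projG_add}` (p227590), leaf-09-g7's `VariationalVectorGaugeSliceB5.nsqV_le_of_B5`
((1.90) at `U = 1`, kernel — pv15's `B5Prop11Lower`; p22xxxx), `VariationalVectorGaugeSlice.{sliceSub, projG}`, `VariationalVectorWeitzenbock.divSq_le_mul_roughV` — BY NAME.
leaf-03-g6's own assembly `ProjGDivControlRegular.divControl_projG_regular` is the case `K = ker Q′_1`, `Q = Q_{lineT 1 R}` with the closeness from a relative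
bound ON `K`; this file displays the closeness as a HYPOTHESIS so that ANY supplier — theirs (`T′ = 1`) or `SliceComplementFlatGap.sliceFlat_close_covariant`
(any unitary frame field `T′`) — plugs in, and absorbs the `‖W‖²` terms by the FLAT (1.90) instead of a Poincaré inequality with background.

THE ARGUMENT ([folklore]; physical units `X ↦ n^{−d}n²·X`; `α = na`).  ONE one-sided closeness `∀ y ∈ S_1: ‖y − Π_{S_R(K)} y‖ ≤ δ‖y‖` gives BOTH
`‖Π_{S_R(K)ᗮ} v‖ ≤ ‖Π_{S_1ᗮ} v‖ + δ‖v‖` (leaf-03-g6) and `‖Π_{S_1} v‖ ≤ ‖Π_{S_R(K)} v‖ + δ‖v‖` (§1); with `‖div_R W − div_1 W‖² ≤ dα²q`: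
`D_R − G_R ≤ 3(D_1 + dα²q + δ²D_R)`, `G_1 ≤ 3(G_R + δ²D_R + dα²q)`; flat (1.90): `D_1 ≤ C_f(S_1 + N_1)`, `q ≤ C_B(S_1 + N_1)` (`C_B = (d+1)Cst(d,1)`, `C_f = d·C_B`);
curl `Cu_1 ≤ 2Cu_R + 8dα²q`; average `N_1 ≤ 2N + c_Q·q`.  Hence `S_1 + N_1 ≤ 3S_R + 2N + 3δ²D_R + θq`, `θ = 7dα² + c_Q`, and under `C_B·θ ≤ ½`,
`(18C_f + 6)δ² ≤ ½`:  **`D_R ≤ (36C_f + 8)·S_R + (24C_f + 4)·N`** (§2 `bookkeeping`, §3 `divControl_of_sliceClose`).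

HONEST FRAMING (T4-DAG p. 1).  Rung (B)+1 only — NOT infinite volume, NOT a mass gap, NOT Clay.  NE2 NOT IN PRINT, NOT proved here.  MODEL LEVEL, `E = ℂ` (the
flat input (1.90) is certified at `E = ℂ`): `R`, `K`, `Q` DATA (c5); the closeness is DISPLAYED here (discharged for covariant frames in file 3, for `T′ = 1` by
leaf-03-g6); constants explicit, NOT optimised.  OURS, [folklore]; nothing printed is a hypothesis; no `def`, no `def … : Prop`, no `sorry`; axioms standard.
V-END with background ∕ NE2 NOT proved; NE3 OPEN; spine PROVED 0∕9.  HONEST DEPENDENCY (cell, verbatim): continuum YM on T⁴ ⇐ BetaPertH ∧ nine spine estimates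
(0/9 proved); BetaPertH ⇐ (D1) ∧ (D4) ∧ CAP+tail; G-an2-4 gates asym, D1 and NE2/3/4.
-/

noncomputable section

namespace Summit.QuantumFields.BalabanUV.T4Continuum.DivControlOfSliceClose

open Finset WithLp
open scoped InnerProductSpace BigOperators
open Literature.MathematicalPhysics.QuantumFieldTheory.Balaban1983to89.B5Prop11Plancherel (Tor fine unitVec Cst)
open Summit.QuantumFields.BalabanUV.T4Continuum.VariationalColourBochner (nsqv nsqv_nonneg)
open Summit.QuantumFields.BalabanUV.T4Continuum.VariationalVectorWeitzenbock (divV divSq divSq_nonneg divSq_le_mul_roughV)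
open Summit.QuantumFields.BalabanUV.T4Continuum.VariationalVectorForm (curlSq ScV qWV curlSq_nonneg qWV_nonneg)
open Summit.QuantumFields.BalabanUV.T4Continuum.VectorBlockTrialForm (nsqV nsqV_nonneg QvL roughV)
open Summit.QuantumFields.BalabanUV.T4Continuum.VariationalVectorGaugeSlice (sliceSub projG projG_nonneg norm_toLp_sq)
open Summit.QuantumFields.BalabanUV.T4Continuum.VariationalVectorGaugeSliceFlat (kerAvgFlat)
open Summit.QuantumFields.BalabanUV.T4Continuum.VariationalVectorGaugeSliceB5 (flatR nsqV_le_of_B5)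
open Summit.QuantumFields.BalabanUV.T4Continuum.CovariantSliceComplement (projDiv divSq_eq_projG_add)
open Summit.QuantumFields.BalabanUV.T4Continuum.SubspacePairPerturbation (norm_sub_starProjection_le_of_oneSided norm_sub_starProjection_le)
open Summit.QuantumFields.BalabanUV.T4Continuum.RegularGaugePerturbation (curlSq_flat_le nsqv_divV_sub_flat_le)

/-! ## §1 One one-sided closeness controls both projected norms (abstract) -/

section Abstract

variable {𝕜 : Type*} [RCLike 𝕜] {H : Type*} [NormedAddCommGroup H] [InnerProductSpace 𝕜 H]

/-- **`‖Π_S v‖ ≤ ‖Π_{S′} v‖ + ε·‖v‖`** whenever every `y ∈ S` has `‖y − Π_{S′} y‖ ≤ ε·‖y‖` (one one-sided closeness, no dimension count):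
`‖P v‖² = Re⟪v, P v⟫`, `P v = Π_{S′}(P v) + q` with `‖q‖ ≤ ε‖P v‖`, and `Re⟪v, Π_{S′} P v⟫ = Re⟪Π_{S′} v, P v⟫ ≤ ‖Π_{S′} v‖·‖P v‖`. [folklore] -/
theorem norm_starProjection_le_of_oneSided' (S S' : Submodule 𝕜 H) [S.HasOrthogonalProjection] [S'.HasOrthogonalProjection] {ε : ℝ}
    (hε : 0 ≤ ε) (h : ∀ y ∈ S, ‖y - S'.starProjection y‖ ≤ ε * ‖y‖) (v : H) :
    ‖S.starProjection v‖ ≤ ‖S'.starProjection v‖ + ε * ‖v‖ := by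
  set p := S.starProjection v with hp
  have h1 : ‖p‖ ^ 2 = RCLike.re ⟪p, v⟫_𝕜 := by
    rw [hp, Submodule.re_inner_starProjection_eq_normSq, Submodule.starProjection_apply, Submodule.coe_norm]
  -- split `p = P′p + (p − P′p)`
  have h2 : RCLike.re ⟪p, v⟫_𝕜 = RCLike.re ⟪S'.starProjection p, v⟫_𝕜 + RCLike.re ⟪p - S'.starProjection p, v⟫_𝕜 := by
    rw [← map_add, ← inner_add_left, add_sub_cancel]
  have h3 : RCLike.re ⟪S'.starProjection p, v⟫_𝕜 ≤ ‖S'.starProjection v‖ * ‖p‖ := by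
    rw [Submodule.inner_starProjection_left_eq_right]
    calc RCLike.re ⟪p, S'.starProjection v⟫_𝕜 ≤ ‖⟪p, S'.starProjection v⟫_𝕜‖ := RCLike.re_le_norm _
      _ ≤ ‖p‖ * ‖S'.starProjection v‖ := norm_inner_le_norm _ _
      _ = _ := mul_comm _ _
  have h4 : RCLike.re ⟪p - S'.starProjection p, v⟫_𝕜 ≤ ε * ‖p‖ * ‖v‖ :=
    calc RCLike.re ⟪p - S'.starProjection p, v⟫_𝕜 ≤ ‖⟪p - S'.starProjection p, v⟫_𝕜‖ := RCLike.re_le_norm _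
      _ ≤ ‖p - S'.starProjection p‖ * ‖v‖ := norm_inner_le_norm _ _
      _ ≤ ε * ‖p‖ * ‖v‖ := mul_le_mul_of_nonneg_right (h p (S.starProjection_apply_mem v)) (norm_nonneg v)
  have h5 : ‖p‖ * ‖p‖ ≤ (‖S'.starProjection v‖ + ε * ‖v‖) * ‖p‖ := by
    rw [← sq, h1, h2]; nlinarith [h3, h4]
  rcases (norm_nonneg p).eq_or_lt with hp0 | hppos
  · rw [← hp0]; positivity
  · exact le_of_mul_le_mul_right h5 hppos

end Abstract

/-! ## §2 The bookkeeping (pure arithmetic) -/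

section Bookkeeping

/-- **the arithmetic of the (GF3) transfer**: `P` (covariant divergence form), `g` (covariant projected functional), `sR = cuR/2 + g` (covariant vector form),
`p1, g1, s1 = cu1/2 + g1` (flat), `q` (`qWV`), `N, N1` (averages), `u = δ²P`, `A = dα²`; inputs = the six comparisons + the two smallness conditions. [folklore] -/
theorem bookkeeping {P g sR p1 g1 s1 cuR cu1 q N N1 CB Cf A cQ u : ℝ}
    (e1 : sR = cuR / 2 + g) (e2 : s1 = cu1 / 2 + g1)
    (h1 : q ≤ CB * (s1 + N1)) (h2 : p1 ≤ Cf * (s1 + N1)) (h3 : cu1 / 2 ≤ cuR + 4 * A * q)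
    (h4 : P - g ≤ 3 * p1 + 3 * (A * q) + 3 * u) (h5 : g1 ≤ 3 * g + 3 * u + 3 * (A * q)) (h6 : N1 ≤ 2 * N + cQ * q)
    (hq0 : 0 ≤ q) (hN0 : 0 ≤ N) (hg0 : 0 ≤ g) (hcuR0 : 0 ≤ cuR) (hCB0 : 0 ≤ CB) (hCf0 : 0 ≤ Cf) (hA0 : 0 ≤ A) (hcQ0 : 0 ≤ cQ) (hu0 : 0 ≤ u)
    (hsmallu : (18 * Cf + 6) * u ≤ P / 2) (hsmallQ : CB * (7 * A + cQ) ≤ 1 / 2) :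
    P ≤ (36 * Cf + 8) * sR + (24 * Cf + 4) * N := by
  -- `X := s1 + N1 ≤ 3sR + 2N + 3u + θq`, `θ = 7A + cQ`
  have hθ0 : 0 ≤ 7 * A + cQ := by positivity
  have hgs : g ≤ sR := by rw [e1]; linarith
  have hsR0 : 0 ≤ sR := hg0.trans hgs
  have hX : s1 + N1 ≤ 3 * sR + 2 * N + 3 * u + (7 * A + cQ) * q := by rw [e2, e1]; linarith [h3, h5, h6]
  have hY0 : 0 ≤ 3 * sR + 2 * N + 3 * u := by positivity
  -- `q ≤ 2CB·(3sR + 2N + 3u)`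
  have hq1 : q ≤ 2 * CB * (3 * sR + 2 * N + 3 * u) := by
    have t0 := mul_le_mul_of_nonneg_left hX hCB0
    have t2 : (CB * (7 * A + cQ)) * q ≤ (1 / 2) * q := mul_le_mul_of_nonneg_right hsmallQ hq0
    have t3 : CB * (3 * sR + 2 * N + 3 * u + (7 * A + cQ) * q) = CB * (3 * sR + 2 * N + 3 * u) + (CB * (7 * A + cQ)) * q := by ring
    linarith [h1, t0, t2, t3]
  -- `θq ≤ 3sR + 2N + 3u`
  have hθq : (7 * A + cQ) * q ≤ 3 * sR + 2 * N + 3 * u := by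
    have t1 : (7 * A + cQ) * q ≤ (7 * A + cQ) * (2 * CB * (3 * sR + 2 * N + 3 * u)) := mul_le_mul_of_nonneg_left hq1 hθ0
    have t2 : (7 * A + cQ) * (2 * CB) ≤ 1 := by linarith [hsmallQ]
    have t3 : (7 * A + cQ) * (2 * CB) * (3 * sR + 2 * N + 3 * u) ≤ 1 * (3 * sR + 2 * N + 3 * u) := mul_le_mul_of_nonneg_right t2 hY0
    have t4 : (7 * A + cQ) * (2 * CB * (3 * sR + 2 * N + 3 * u)) = (7 * A + cQ) * (2 * CB) * (3 * sR + 2 * N + 3 * u) := by ring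
    linarith [t1, t3, t4]
  -- `P ≤ sR + 3Cf·X + θq + 3u`
  have hAq : 0 ≤ A * q := mul_nonneg hA0 hq0
  have hcq : 0 ≤ cQ * q := mul_nonneg hcQ0 hq0
  have hP1 : P ≤ sR + 3 * (Cf * (s1 + N1)) + (7 * A + cQ) * q + 3 * u := by
    have t : (7 * A + cQ) * q = 7 * (A * q) + cQ * q := by ring
    linarith [h4, h2, hgs, t]
  have hP2 : 3 * (Cf * (s1 + N1)) ≤ 3 * Cf * (3 * sR + 2 * N + 3 * u) + 3 * Cf * ((7 * A + cQ) * q) := by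
    have t0 := mul_le_mul_of_nonneg_left hX hCf0
    have t1 : Cf * (3 * sR + 2 * N + 3 * u + (7 * A + cQ) * q) = Cf * (3 * sR + 2 * N + 3 * u) + Cf * ((7 * A + cQ) * q) := by ring
    linarith [t0, t1]
  have hP3 : 3 * Cf * ((7 * A + cQ) * q) ≤ 3 * Cf * (3 * sR + 2 * N + 3 * u) := mul_le_mul_of_nonneg_left hθq (by positivity)
  have hPmain : P ≤ (18 * Cf + 4) * sR + (12 * Cf + 2) * N + (18 * Cf + 6) * u := by linarith [hP1, hP2, hP3, hθq]
  linarith [hPmain, hsmallu]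

/-- `(x ≤ a + b + c, 0 ≤ x) ⟹ x² ≤ 3a² + 3b² + 3c²`. [folklore] -/
theorem sq_le_three {x a b c : ℝ} (hx : 0 ≤ x) (h : x ≤ a + b + c) : x ^ 2 ≤ 3 * a ^ 2 + 3 * b ^ 2 + 3 * c ^ 2 := by
  have h1 := pow_le_pow_left₀ hx h 2
  nlinarith [h1, sq_nonneg (a - b), sq_nonneg (a - c), sq_nonneg (b - c)]

end Bookkeeping

/-! ## §3 (GF3) from one displayed one-sided closeness — any `K`, any `Q`, no plaquette hypothesis (`E = ℂ`) -/

section Assembly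

variable {d : ℕ} (n : ℕ) [NeZero n] (M : Fin d → ℕ) [hM : ∀ μ, NeZero (M μ)]

/-- **(GF3) FROM THE ONE-SIDED SLICE CLOSENESS** (model level, `E = ℂ`).  `‖R − 1‖ ≤ a`; a submodule `K` of fine 0-forms whose covariant slice subspace
`S_R(K)` is one-sidedly `δ`-close to the flat one: `∀ y ∈ S_1(ker Q′_1), ‖y − Π_{S_R(K)} y‖ ≤ δ‖y‖` (`0 ≤ δ`); an average `Q` with
`nsqV (Q_1 W) ≤ 2·nsqV (Q W) + c_Q·qWV W` (`0 ≤ c_Q`); numeric smallness `(18C_f + 6)·δ² ≤ ½`, `C_B·(7d(na)² + c_Q) ≤ ½` (`C_B = (d+1)Cst(d,1)`, `C_f = d·C_B`).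
THEN for every 1-form `W`:  `n^{−d}(n²·divSq_R W) ≤ (36C_f + 8)·ScV n M R (projG R K) W + (24C_f + 4)·nsqV (Q W)`. [folklore] -/
theorem divControl_of_sliceClose {R : Tor (fine n M) → Fin d → (ℂ →L[ℂ] ℂ)} {a : ℝ} (ha : ∀ x μ, ‖R x μ - 1‖ ≤ a)
    (K : Submodule ℂ (Tor (fine n M) → ℂ)) {δ : ℝ} (hδ0 : 0 ≤ δ)
    (hclose : ∀ y ∈ sliceSub (fine n M) (flatR n M) (kerAvgFlat n M), ‖y - (sliceSub (fine n M) R K).starProjection y‖ ≤ δ * ‖y‖)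
    {Q : (Tor (fine n M) → Fin d → ℂ) → (Tor M → Fin d → ℂ)} {cQ : ℝ} (hcQ : 0 ≤ cQ)
    (hQ : ∀ W, nsqV M (QvL n M (fun _ _ _ _ => (1 : ℂ →L[ℂ] ℂ)) W) ≤ 2 * nsqV M (Q W) + cQ * qWV n M W)
    (hsmallδ : (18 * (d * ((d + 1 : ℝ) * Cst d 1)) + 6) * δ ^ 2 ≤ 1 / 2)
    (hsmallQ : ((d + 1 : ℝ) * Cst d 1) * (7 * (d * ((n : ℝ) * a) ^ 2) + cQ) ≤ 1 / 2)
    (W : Tor (fine n M) → Fin d → ℂ) :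
    ((n : ℝ) ^ d)⁻¹ * ((n : ℝ) ^ 2 * divSq (fine n M) R W)
      ≤ (36 * (d * ((d + 1 : ℝ) * Cst d 1)) + 8) * ScV n M R (projG (fine n M) R K) W + (24 * (d * ((d + 1 : ℝ) * Cst d 1)) + 4) * nsqV M (Q W) := by
  have hn : (0 : ℝ) < n := by exact_mod_cast Nat.pos_of_ne_zero (NeZero.ne n)
  have hν : (0 : ℝ) < ((n : ℝ) ^ d)⁻¹ := by positivity
  have hνn2 : (0 : ℝ) ≤ ((n : ℝ) ^ d)⁻¹ * (n : ℝ) ^ 2 := by positivity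
  have hCB0 : 0 ≤ (d + 1 : ℝ) * Cst d 1 := by
    have := Literature.MathematicalPhysics.QuantumFieldTheory.Balaban1983to89.B5Prop11Lower.one_le_Cst (d := d) (1 : ℝ); positivity
  have hd0 : (0 : ℝ) ≤ d := Nat.cast_nonneg d
  have hU1 : ∀ (x : Tor (fine n M)) (μ : Fin d), flatR n M x μ ∈ unitary (ℂ →L[ℂ] ℂ) := fun _ _ => Submonoid.one_mem _
  -- the two PiLp vectors
  obtain ⟨bR, hbR⟩ : ∃ b : PiLp 2 (fun _ : Tor (fine n M) => ℂ), b = toLp 2 (divV (fine n M) R W) := ⟨_, rfl⟩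
  obtain ⟨b1, hb1⟩ : ∃ b : PiLp 2 (fun _ : Tor (fine n M) => ℂ), b = toLp 2 (divV (fine n M) (flatR n M) W) := ⟨_, rfl⟩
  have eDR : divSq (fine n M) R W = ‖bR‖ ^ 2 := by rw [hbR, norm_toLp_sq]; rfl
  have eD1 : divSq (fine n M) (flatR n M) W = ‖b1‖ ^ 2 := by rw [hb1, norm_toLp_sq]; rfl
  have eGR : projG (fine n M) R K W = ‖(sliceSub (fine n M) R K).starProjection bR‖ ^ 2 := by rw [hbR]; rfl
  have eG1 : projG (fine n M) (flatR n M) (kerAvgFlat n M) W = ‖(sliceSub (fine n M) (flatR n M) (kerAvgFlat n M)).starProjection b1‖ ^ 2 := by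
    rw [hb1]; rfl
  have ePG : divSq (fine n M) R W = projG (fine n M) R K W + ‖bR - (sliceSub (fine n M) R K).starProjection bR‖ ^ 2 := by
    rw [divSq_eq_projG_add (fine n M) R K W, hbR]
    congr 1
    rw [show (sliceSub (fine n M) R K).starProjection (toLp 2 (divV (fine n M) R W)) = toLp 2 (projDiv (fine n M) R K W) by rw [projDiv, toLp_ofLp],
      ← toLp_sub, norm_toLp_sq]
    rfl
  -- (f3) the divergence perturbation
  have f3 : ‖bR - b1‖ ^ 2 ≤ d * a ^ 2 * nsqV (fine n M) W := by
    rw [hbR, hb1, ← toLp_sub, norm_toLp_sq]; exact nsqv_divV_sub_flat_le (fine n M) ha W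
  -- (f4) complementary part, (f5) flat projected part
  have f4 : ‖bR - (sliceSub (fine n M) R K).starProjection bR‖ ≤ ‖b1‖ + ‖bR - b1‖ + δ * ‖bR‖ := by
    have h1 := norm_sub_starProjection_le_of_oneSided _ _ hclose bR
    have h2 : ‖(sliceSub (fine n M) (flatR n M) (kerAvgFlat n M)).starProjection bR‖ ≤ ‖bR‖ := Submodule.norm_starProjection_apply_le _ bR
    have h3 : ‖bR - (sliceSub (fine n M) (flatR n M) (kerAvgFlat n M)).starProjection bR‖ ≤ ‖b1‖ + ‖bR - b1‖ := by
      have e : bR - (sliceSub (fine n M) (flatR n M) (kerAvgFlat n M)).starProjection bR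
          = (b1 - (sliceSub (fine n M) (flatR n M) (kerAvgFlat n M)).starProjection b1)
            + ((bR - b1) - (sliceSub (fine n M) (flatR n M) (kerAvgFlat n M)).starProjection (bR - b1)) := by
        rw [map_sub]; abel
      rw [e]
      exact (norm_add_le _ _).trans (add_le_add (norm_sub_starProjection_le _ b1) (norm_sub_starProjection_le _ _))
    have h4 := mul_le_mul_of_nonneg_left h2 hδ0
    linarith [h1, h3, h4]
  have f5 : ‖(sliceSub (fine n M) (flatR n M) (kerAvgFlat n M)).starProjection b1‖
      ≤ ‖(sliceSub (fine n M) R K).starProjection bR‖ + δ * ‖bR‖ + ‖bR - b1‖ := by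
    have h1 := norm_starProjection_le_of_oneSided' _ _ hδ0 hclose bR
    have h2 : ‖(sliceSub (fine n M) (flatR n M) (kerAvgFlat n M)).starProjection b1‖
        ≤ ‖(sliceSub (fine n M) (flatR n M) (kerAvgFlat n M)).starProjection bR‖ + ‖bR - b1‖ := by
      calc _ = ‖(sliceSub (fine n M) (flatR n M) (kerAvgFlat n M)).starProjection bR
              - (sliceSub (fine n M) (flatR n M) (kerAvgFlat n M)).starProjection (bR - b1)‖ := by rw [map_sub, sub_sub_cancel]
        _ ≤ _ := norm_sub_le _ _
        _ ≤ _ := add_le_add le_rfl (Submodule.norm_starProjection_apply_le _ _)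
    linarith
  -- squared, lattice units
  have f4sq : divSq (fine n M) R W - projG (fine n M) R K W
      ≤ 3 * divSq (fine n M) (flatR n M) W + 3 * (d * a ^ 2 * nsqV (fine n M) W) + 3 * (δ ^ 2 * divSq (fine n M) R W) := by
    have hsq := sq_le_three (norm_nonneg _) f4
    have hco : divSq (fine n M) R W - projG (fine n M) R K W = ‖bR - (sliceSub (fine n M) R K).starProjection bR‖ ^ 2 := by
      rw [ePG]; ring
    rw [hco, eD1, eDR, show 3 * (δ ^ 2 * ‖bR‖ ^ 2) = 3 * (δ * ‖bR‖) ^ 2 by ring]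
    linarith [hsq, f3]
  have f5sq : projG (fine n M) (flatR n M) (kerAvgFlat n M) W
      ≤ 3 * projG (fine n M) R K W + 3 * (δ ^ 2 * divSq (fine n M) R W) + 3 * (d * a ^ 2 * nsqV (fine n M) W) := by
    have hsq := sq_le_three (norm_nonneg _) f5
    rw [eG1, eGR, eDR, show 3 * (δ ^ 2 * ‖bR‖ ^ 2) = 3 * (δ * ‖bR‖) ^ 2 by ring]
    linarith [hsq, f3]
  -- the flat (1.90)
  have hflat := nsqV_le_of_B5 n M one_pos W
  rw [one_mul] at hflat
  have hdiv1 := divSq_le_mul_roughV n M hU1 W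
  have hcurl := curlSq_flat_le (fine n M) (R := R) ha W
  -- physical units: multiply through by `ν = n^{−d}` (and `n²`)
  have k1 : qWV n M W ≤ ((d + 1 : ℝ) * Cst d 1) * (ScV n M (flatR n M) (projG (fine n M) (flatR n M) (kerAvgFlat n M)) W
      + nsqV M (QvL n M (fun _ _ _ _ => (1 : ℂ →L[ℂ] ℂ)) W)) := by
    have h := mul_le_mul_of_nonneg_left hflat.1 hν.le
    unfold qWV
    calc _ ≤ _ := h
      _ = _ := by field_simp
  have k2 : ((n : ℝ) ^ d)⁻¹ * ((n : ℝ) ^ 2 * divSq (fine n M) (flatR n M) W)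
      ≤ (d * ((d + 1 : ℝ) * Cst d 1)) * (ScV n M (flatR n M) (projG (fine n M) (flatR n M) (kerAvgFlat n M)) W
        + nsqV M (QvL n M (fun _ _ _ _ => (1 : ℂ →L[ℂ] ℂ)) W)) := by
    have h2 : (n : ℝ) ^ 2 * divSq (fine n M) (flatR n M) W ≤ d * ((n : ℝ) ^ 2 * roughV n M (flatR n M) W) := by
      have := mul_le_mul_of_nonneg_left hdiv1 (sq_nonneg (n : ℝ)); linarith
    have h3 := mul_le_mul_of_nonneg_left (h2.trans (mul_le_mul_of_nonneg_left hflat.2 hd0)) hν.le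
    calc _ ≤ _ := h3
      _ = _ := by field_simp
  have k3 : ((n : ℝ) ^ d)⁻¹ * ((n : ℝ) ^ 2 * curlSq (fine n M) (flatR n M) W) / 2
      ≤ ((n : ℝ) ^ d)⁻¹ * ((n : ℝ) ^ 2 * curlSq (fine n M) R W) + 4 * (d * ((n : ℝ) * a) ^ 2) * qWV n M W := by
    have h := mul_le_mul_of_nonneg_left hcurl hνn2
    unfold qWV
    have e : ((n : ℝ) ^ d)⁻¹ * (n : ℝ) ^ 2 * (2 * curlSq (fine n M) R W + 8 * d * a ^ 2 * nsqV (fine n M) W)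
        = 2 * (((n : ℝ) ^ d)⁻¹ * ((n : ℝ) ^ 2 * curlSq (fine n M) R W)) + 8 * (d * ((n : ℝ) * a) ^ 2) * (((n : ℝ) ^ d)⁻¹ * nsqV (fine n M) W) := by ring
    have e' : ((n : ℝ) ^ d)⁻¹ * (n : ℝ) ^ 2 * curlSq (fine n M) (flatR n M) W = ((n : ℝ) ^ d)⁻¹ * ((n : ℝ) ^ 2 * curlSq (fine n M) (flatR n M) W) := by ring
    rw [e, e'] at h
    linarith
  have k4 : ((n : ℝ) ^ d)⁻¹ * ((n : ℝ) ^ 2 * divSq (fine n M) R W) - ((n : ℝ) ^ d)⁻¹ * ((n : ℝ) ^ 2 * projG (fine n M) R K W)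
      ≤ 3 * (((n : ℝ) ^ d)⁻¹ * ((n : ℝ) ^ 2 * divSq (fine n M) (flatR n M) W)) + 3 * (d * ((n : ℝ) * a) ^ 2 * qWV n M W)
        + 3 * (δ ^ 2 * (((n : ℝ) ^ d)⁻¹ * ((n : ℝ) ^ 2 * divSq (fine n M) R W))) := by
    have h := mul_le_mul_of_nonneg_left f4sq hνn2
    unfold qWV
    have e : ((n : ℝ) ^ d)⁻¹ * (n : ℝ) ^ 2 * (3 * divSq (fine n M) (flatR n M) W + 3 * (d * a ^ 2 * nsqV (fine n M) W) + 3 * (δ ^ 2 * divSq (fine n M) R W))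
        = 3 * (((n : ℝ) ^ d)⁻¹ * ((n : ℝ) ^ 2 * divSq (fine n M) (flatR n M) W)) + 3 * (d * ((n : ℝ) * a) ^ 2 * (((n : ℝ) ^ d)⁻¹ * nsqV (fine n M) W))
          + 3 * (δ ^ 2 * (((n : ℝ) ^ d)⁻¹ * ((n : ℝ) ^ 2 * divSq (fine n M) R W))) := by ring
    have e' : ((n : ℝ) ^ d)⁻¹ * (n : ℝ) ^ 2 * (divSq (fine n M) R W - projG (fine n M) R K W)
        = ((n : ℝ) ^ d)⁻¹ * ((n : ℝ) ^ 2 * divSq (fine n M) R W) - ((n : ℝ) ^ d)⁻¹ * ((n : ℝ) ^ 2 * projG (fine n M) R K W) := by ring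
    rw [e, e'] at h
    exact h
  have k5 : ((n : ℝ) ^ d)⁻¹ * ((n : ℝ) ^ 2 * projG (fine n M) (flatR n M) (kerAvgFlat n M) W)
      ≤ 3 * (((n : ℝ) ^ d)⁻¹ * ((n : ℝ) ^ 2 * projG (fine n M) R K W)) + 3 * (δ ^ 2 * (((n : ℝ) ^ d)⁻¹ * ((n : ℝ) ^ 2 * divSq (fine n M) R W)))
        + 3 * (d * ((n : ℝ) * a) ^ 2 * qWV n M W) := by
    have h := mul_le_mul_of_nonneg_left f5sq hνn2
    unfold qWV
    have e : ((n : ℝ) ^ d)⁻¹ * (n : ℝ) ^ 2 * (3 * projG (fine n M) R K W + 3 * (δ ^ 2 * divSq (fine n M) R W) + 3 * (d * a ^ 2 * nsqV (fine n M) W))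
        = 3 * (((n : ℝ) ^ d)⁻¹ * ((n : ℝ) ^ 2 * projG (fine n M) R K W)) + 3 * (δ ^ 2 * (((n : ℝ) ^ d)⁻¹ * ((n : ℝ) ^ 2 * divSq (fine n M) R W)))
          + 3 * (d * ((n : ℝ) * a) ^ 2 * (((n : ℝ) ^ d)⁻¹ * nsqV (fine n M) W)) := by ring
    have e' : ((n : ℝ) ^ d)⁻¹ * (n : ℝ) ^ 2 * projG (fine n M) (flatR n M) (kerAvgFlat n M) W
        = ((n : ℝ) ^ d)⁻¹ * ((n : ℝ) ^ 2 * projG (fine n M) (flatR n M) (kerAvgFlat n M) W) := by ring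
    rw [e, e'] at h
    exact h
  have hP0 : 0 ≤ ((n : ℝ) ^ d)⁻¹ * ((n : ℝ) ^ 2 * divSq (fine n M) R W) := by have := divSq_nonneg (fine n M) R W; positivity
  have k6 : (18 * (d * ((d + 1 : ℝ) * Cst d 1)) + 6) * (δ ^ 2 * (((n : ℝ) ^ d)⁻¹ * ((n : ℝ) ^ 2 * divSq (fine n M) R W)))
      ≤ ((n : ℝ) ^ d)⁻¹ * ((n : ℝ) ^ 2 * divSq (fine n M) R W) / 2 := by
    have := mul_le_mul_of_nonneg_right hsmallδ hP0
    calc _ = (18 * (d * ((d + 1 : ℝ) * Cst d 1)) + 6) * δ ^ 2 * (((n : ℝ) ^ d)⁻¹ * ((n : ℝ) ^ 2 * divSq (fine n M) R W)) := by ring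
      _ ≤ _ := this
      _ = _ := by ring
  exact bookkeeping (P := ((n : ℝ) ^ d)⁻¹ * ((n : ℝ) ^ 2 * divSq (fine n M) R W)) (g := ((n : ℝ) ^ d)⁻¹ * ((n : ℝ) ^ 2 * projG (fine n M) R K W))
    (sR := ScV n M R (projG (fine n M) R K) W) (p1 := ((n : ℝ) ^ d)⁻¹ * ((n : ℝ) ^ 2 * divSq (fine n M) (flatR n M) W))
    (g1 := ((n : ℝ) ^ d)⁻¹ * ((n : ℝ) ^ 2 * projG (fine n M) (flatR n M) (kerAvgFlat n M) W))
    (s1 := ScV n M (flatR n M) (projG (fine n M) (flatR n M) (kerAvgFlat n M)) W)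
    (cuR := ((n : ℝ) ^ d)⁻¹ * ((n : ℝ) ^ 2 * curlSq (fine n M) R W)) (cu1 := ((n : ℝ) ^ d)⁻¹ * ((n : ℝ) ^ 2 * curlSq (fine n M) (flatR n M) W))
    (q := qWV n M W) (N := nsqV M (Q W)) (N1 := nsqV M (QvL n M (fun _ _ _ _ => (1 : ℂ →L[ℂ] ℂ)) W)) (CB := (d + 1 : ℝ) * Cst d 1)
    (Cf := d * ((d + 1 : ℝ) * Cst d 1)) (A := d * ((n : ℝ) * a) ^ 2) (cQ := cQ)
    (u := δ ^ 2 * (((n : ℝ) ^ d)⁻¹ * ((n : ℝ) ^ 2 * divSq (fine n M) R W)))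
    (by unfold ScV; ring) (by unfold ScV; ring) k1 k2 k3 k4 k5 (hQ W) (qWV_nonneg n M W) (nsqV_nonneg M _)
    (by have := projG_nonneg (fine n M) R K W; positivity) (by have := curlSq_nonneg (fine n M) R W; positivity) hCB0 (by positivity)
    (by positivity) hcQ (by positivity) k6 hsmallQ

end Assembly

end Summit.QuantumFields.BalabanUV.T4Continuum.DivControlOfSliceClose

end
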